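import Summits.QuantumFields.YangMills.Theses.CertificationLength

/-!
# Repaired statement C′ for crux `CompleteAnalyticityAtLargeScales` (stmt-QuantumFields-16178) — evidence only

`CompleteAnalyticityAtLargeScalesSC` is the crux VERBATIM with one binder added after `IsCompactSimpleLieGroup G →`:
`SimplyConnectedSpace G →` (π₁(G) = 0).  The forced π₁-monopole world-line witness (G = SO(3), see ATTACK-16178.md)
needs π₁(G) ≠ 0 and misses C′.  `sc_of_original` records that C′ is a weakening of the crux (so nothing proved
from C′ is lost if the crux were true), and that the signature elaborates against the route file's imports.
-/

namespace Summit.QuantumFields.YangMills.Cruxes.CompleteAnalyticityAtLargeScales.Repair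

open MeasureTheory
open Literature.MathematicalPhysics.QuantumFieldTheory
open Literature.MathematicalPhysics.QuantumLattice
open Literature.MathematicalPhysics.AQFT

/-- C′: Dobrushin–Shlosman certifiability of the 4-d Wilson theory at every large coupling, at arbitrarily large
scales, for compact simple SIMPLY CONNECTED `G` (SU(N), Sp(N), Spin(N), E₆,E₇,E₈,F₄,G₂) and faithful unitary `r`. -/
def CompleteAnalyticityAtLargeScalesSC : Prop :=
  ∀ (G : Type) [Group G] [TopologicalSpace G] [IsTopologicalGroup G] [CompactSpace G],
    IsCompactSimpleLieGroup G → SimplyConnectedSpace G →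
    letI : MeasurableSpace G := borel G; haveI : BorelSpace G := ⟨rfl⟩;
    ∀ r : LatticeRep G, ∃ (n : ℕ) (ε : ℝ), 1 ≤ n ∧ 0 ≤ ε ∧ ε * ((((4 * n + 3) ^ 4 - (4 * n + 1) ^ 4 : ℕ)) : ℝ) < 1 ∧
      ∀ B : ℕ, ∃ β₂ : ℝ, ∀ β : ℝ, β₂ ≤ β → ∃ b : ℕ, B ≤ b ∧ 1 ≤ b ∧
        (∀ w : Fin 4 → ℤ → ℤ, (∀ i j, w i j + ((b : ℕ) : ℤ) ≤ w i (j + 1) ∧ w i (j + 1) ≤ w i j + 2 * ((b : ℕ) : ℤ)) → ∀ Y : Finset (Fin 4 → ℤ), Y ⊆ (Fintype.piFinset fun _ : Fin 4 => Finset.Icc (-(2 * ((n : ℕ) : ℤ))) (2 * ((n : ℕ) : ℤ))) → (0 : Fin 4 → ℤ) ∈ Y → ∀ η η' : LGConfig 4 G, (∀ e ∈ (Fintype.piFinset fun _ : Fin 4 => Finset.Icc (-(2 * ((n : ℕ) : ℤ))) (2 * ((n : ℕ) : ℤ))).biUnion (fun y : Fin 4 → ℤ => (Fintype.piFinset fun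 i : Fin 4 => Finset.Ico (w i (y i)) (w i (y i + 1))) ×ˢ (Finset.univ : Finset (Fin 4))), η e = η' e) → ∀ f : LGConfig 4 G → ℝ, IsCylinder f ((fun y : Fin 4 → ℤ => (Fintype.piFinset fun i : Fin 4 => Finset.Ico (w i (y i)) (w i (y i + 1))) ×ˢ (Finset.univ : Finset (Fin 4))) 0) → Measurable f → (∀ U, 0 ≤ f U ∧ f U ≤ 1) → |(∫ U, f U ∂(ymSpecification r.ρ β (Y.biUnion (fun y : Fin 4 → ℤ => (Fintype.piFinset fun i : Fin 4 => Finset.Ico (w i (y i)) (w i (y i + 1))) ×ˢ (Finset.univ : Finset (Fin 4)))) η)) - ∫ U, f U ∂(ymSpecification r.ρ β (Y.biUnion (fun y : Fin 4 → ℤ => (Fintype.piFinset fun i : Fin 4 => Finset.Ico (w i (y i)) (w i (y i + 1))) ×ˢ (Finset.univ : Finset (Fin 4)))) η')| ≤ ε)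

/-- C′ is a weakening of the crux as filed (drop the new binder). -/
theorem sc_of_original
    (h : Summit.QuantumFields.YangMills.Theses.CertificationLength.CompleteAnalyticityAtLargeScales) :
    CompleteAnalyticityAtLargeScalesSC := by
  intro G _ _ _ _ hG _hsc
  exact h G hG

end Summit.QuantumFields.YangMills.Cruxes.CompleteAnalyticityAtLargeScales.Repair
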